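import Summits.RiemannHypothesis.RiemannHypothesis.Theorems.WeilColumnThetaInterfaceBounds
import Summits.RiemannHypothesis.RiemannHypothesis.Theorems.WeilColumnThetaMajorantD2
import HarnessLib

/-!
# D3 HYPOTHESIS-FREE: `∫‖(T⁻)′‖² ≤ P.B` for every admissible row (RH-FREE; D3 ∘ D2)

Cell `rh-explicit`, WEIL column, seat handoff-prove-2 gen12.  `WeilColumnThetaInterfaceBounds.integral_norm_sq_deriv_TOdd_le` took the
derivative of `Θ` and the D2 majorant as hypotheses; cc-s2-3's `WeilColumnThetaMajorantD2` (`hasDerivAt_deriv_Θ`, `D2_on_Ioc`) supplies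
both, so for an admissible row, with no further hypothesis:

* `ThetaParams.hasDerivAt_TOdd_of_admissible` — `T⁻` is differentiable everywhere (explicit derivative with `Θ′ = deriv Θ`);
* **`ThetaParams.integral_norm_sq_deriv_TOdd_le_of_admissible (hP : P.Admissible qn) : ∫ x, ‖deriv P.TOdd x‖² ≤ P.B`**.
Together with `integral_norm_sq_TOdd_le` (`≤ P.A`) these are the `A`, `B` of the checker.  Nothing here bears on the truth of RH.
-/

noncomputable section

set_option linter.dupNamespace false

open Complex Set MeasureTheory Filter
open scoped Real Topology

namespace Summit.RiemannHypothesis.RiemannHypothesis.Theorems.WeilColumn.ThetaMellin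

open Literature.NumberTheory.LFunctions

namespace ThetaParams

variable (P : ThetaParams)

/-- `T⁻` is differentiable at every point, for an admissible row (D2 supplies `Θ′ = deriv Θ` on `(0,∞)`). -/
theorem hasDerivAt_TOdd_of_admissible {qn : ℕ} (hP : P.Admissible qn) (x : ℝ) :
    HasDerivAt P.TOdd (deriv P.TOdd x) x :=
  (P.hasDerivAt_TOdd hP (Θ' := deriv P.Θ) (fun _ hu ↦ P.hasDerivAt_deriv_Θ hP hu) x).differentiableAt.hasDerivAt

/-- **`∫‖(T⁻)′‖² ≤ P.B`** for every admissible row — no hypothesis left. [THETA-CERT-cc6 §D2+D3] -/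
theorem integral_norm_sq_deriv_TOdd_le_of_admissible {qn : ℕ} (hP : P.Admissible qn) :
    ∫ x, ‖deriv P.TOdd x‖ ^ 2 ≤ P.B :=
  P.integral_norm_sq_deriv_TOdd_le hP (Θ' := deriv P.Θ) (fun _ hu ↦ P.hasDerivAt_deriv_Θ hP hu) (P.D2_on_Ioc hP)

end ThetaParams

end Summit.RiemannHypothesis.RiemannHypothesis.Theorems.WeilColumn.ThetaMellin

end
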